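import Summits.CriticalPhenomena.PercolationContinuityZ3.Theorems.Transplant.ReflexSlabArms
import HarnessLib

/-!
# REFLEX sector-slabs with TWO pockets in one quadrant `ℝ𝕎_{c₁,c₂} = {x ∈ S_k | x₂ ≥ 0 ∨ c₁·x₂ ≤ x₁ ∨ c₂·x₁ ≤ x₂}`: the station design, II —
# the bottom face

builds on p205010 (kernel theorem, internal audit signed; external expert review pending) — NOT used in this file.
Lane `prim-bschramm`, seat `prim-bschramm-p2` (gen 23; class C1b, METHOD = input substitution; memo `HOME/bschramm/P2-LATTICES.md` §83);
helper file (`--supports stmt-CriticalPhenomena-4575 --as helper`).  A bottom-face vertex `u = (u₀, −N, u₂)` with exit `b = u − e₁ ∈ ℝ𝕎`: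
* `c₂·b₁ ≤ b₂` (the exit lies under the right half or in the SOUTH pocket, `u₂ ≥ −c₂(N+1)`): the RIGHTWARD chain of the wide family (swapped arm to
  `{x₂ = 3N+5}`, connector `(u₀, −(2N+3), N+2)` leaning `+e₂`, the sweep) — its swapped arm stays in `ℝ𝕎` since `c₂x₁ ≤ c₂b₁ ≤ b₂ ≤ x₂`;
* `c₁·b₂ ≤ b₁` (the exit lies in the WEST pocket, `c₁|u₂| ≥ N+1`, so `c₁ ≥ 1`): the LEFTWARD pocket chain of the wide family verbatim.
**`rtw_design_bottom`** (`P ≥ α₄·α·αₛ`, `≤ 2k+2` edges, window `k + 5N + 7`); helpers `mem_rtw_of_southArm`, `mem_rtw_of_le`, `mem_rtw_of_pocketArm`.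
Independent of `ReflexQuadPocketDesign`; both are assembled in `ReflexQuadPocketRow`.
[cite: AizenmanChayesChayesFrohlichRusso1983, §4 Thm 4.4, Cor. to Lemma 4.3, Lemma 4.2 (a)] [cite: GrimmettPercolation1999, §7.2 p. 148] -/

noncomputable section

namespace Summit.CriticalPhenomena.PercolationContinuityZ3.Theorems.Transplant

namespace ReflexQuadPocket

open MeasureTheory Literature.Probability.Percolation Literature.Probability.LatticeModels SimpleGraph HSU OrthantUniq HalfSlabUniq
  ConeSlabUniq ThinConeSlab RationalHalfSlab ThreeQuarterSlab ReflexSlab Filter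
open scoped Classical Topology

variable {k : ℕ} {N : ℕ} {c₁ c₂ : ℝ}

/-- **The rightward swapped arm from an apex `b` with `c₂·b₁ ≤ b₂` stays in `ℝ𝕎`**: `x₁ ≤ b₁`, `b₂ ≤ x₂` (`c₂ ≥ 0`). [folklore] -/
theorem mem_rtw_of_southArm (hc₂ : 0 ≤ c₂) {b x : Site 3} (hs : c₂ * (b 1 : ℝ) ≤ (b 2 : ℝ)) (hx0 : x ∈ slab 3 k) (h1 : x 1 ≤ b 1)
    (h2 : b 2 ≤ x 2) : x ∈ {x : Site 3 | x ∈ slab 3 k ∧ (0 ≤ x 2 ∨ c₁ * (x 2 : ℝ) ≤ (x 1 : ℝ) ∨ c₂ * (x 1 : ℝ) ≤ (x 2 : ℝ))} := by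
  have h1r : (x 1 : ℝ) ≤ (b 1 : ℝ) := by exact_mod_cast h1
  have h2r : (b 2 : ℝ) ≤ (x 2 : ℝ) := by exact_mod_cast h2
  exact ⟨hx0, Or.inr (Or.inr (((mul_le_mul_of_nonneg_left h1r hc₂).trans hs).trans h2r))⟩

/-- **Below the anti-diagonal on the left: `x₂ ≤ 0`, `x₂ ≤ x₁` ⇒ `x ∈ ℝ𝕎`** when `c₁ ≥ 1`. [folklore] -/
theorem mem_rtw_of_le (hc1 : 1 ≤ c₁) {x : Site 3} (hx0 : x ∈ slab 3 k) (h2 : x 2 ≤ 0) (h12 : x 2 ≤ x 1) : x ∈ {x : Site 3 | x ∈ slab 3 k ∧ (0 ≤ x 2 ∨ c₁ * (x 2 : ℝ) ≤ (x 1 : ℝ) ∨ c₂ * (x 1 : ℝ) ≤ (x 2 : ℝ))} := by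
  have h2r : (x 2 : ℝ) ≤ 0 := by exact_mod_cast h2
  have h12r : (x 2 : ℝ) ≤ (x 1 : ℝ) := by exact_mod_cast h12
  have e1 : c₁ * (x 2 : ℝ) ≤ 1 * (x 2 : ℝ) := mul_le_mul_of_nonpos_right hc1 h2r
  exact ⟨hx0, Or.inr (Or.inl (by linarith))⟩

/-- **The leftward descending arm from an apex `b` with `c₁·b₂ ≤ b₁` stays in `ℝ𝕎`** (`c₁ ≥ 1`): `x₁ ≤ b₁`, `b₁ − x₁ ≤ b₂ − x₂`. [folklore] -/
theorem mem_rtw_of_pocketArm (hc1 : 1 ≤ c₁) {b x : Site 3} (hb : c₁ * (b 2 : ℝ) ≤ (b 1 : ℝ)) (hx0 : x ∈ slab 3 k) (h1 : x 1 ≤ b 1)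
    (h12 : b 1 - x 1 ≤ b 2 - x 2) : x ∈ {x : Site 3 | x ∈ slab 3 k ∧ (0 ≤ x 2 ∨ c₁ * (x 2 : ℝ) ≤ (x 1 : ℝ) ∨ c₂ * (x 1 : ℝ) ≤ (x 2 : ℝ))} := by
  have h1r : (x 1 : ℝ) ≤ (b 1 : ℝ) := by exact_mod_cast h1
  have h12r : (b 1 : ℝ) - (x 1 : ℝ) ≤ (b 2 : ℝ) - (x 2 : ℝ) := by exact_mod_cast h12
  have hd : (x 2 : ℝ) - (b 2 : ℝ) ≤ 0 := by linarith
  have e1 : c₁ * ((x 2 : ℝ) - (b 2 : ℝ)) ≤ 1 * ((x 2 : ℝ) - (b 2 : ℝ)) := mul_le_mul_of_nonpos_right hc1 hd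
  refine ⟨hx0, Or.inr (Or.inl ?_)⟩
  have : c₁ * (x 2 : ℝ) = c₁ * (b 2 : ℝ) + c₁ * ((x 2 : ℝ) - (b 2 : ℝ)) := by ring
  linarith

/-- **The design at a BOTTOM-face vertex of `ℝ𝕎`** (`u₁ = −N`, exit `u − e₁ ∈ ℝ𝕎`; `0 ≤ c₂ ≤ c₁`, `N ≥ k+1`): the rightward chain when
`c₂·b₁ ≤ b₂`, the leftward pocket chain when `c₁·b₂ ≤ b₁`; `P_{p'} ≥ α₄·α·αₛ`, `≤ 2k + 2` extra edges, window `k + 5N + 7`, station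
`Ω = (0, N+1, −(4N+6))`. [cite: AizenmanChayesChayesFrohlichRusso1983, §4 Cor. to Lemma 4.3, Lemma 4.2 (a)] -/
theorem rtw_design_bottom (hc₂ : 0 ≤ c₂) (hc : c₂ ≤ c₁) (hN : k + 1 ≤ N) {p' : unitInterval} (A : SlabArmKit k p') {α₄ αₛ : ℝ} (hα₄ : 0 < α₄)
    (harm₄ : ∀ σ : ℤ, (σ = 1 ∨ σ = -1) → ∀ b : Site 3, b ∈ slab 3 k →
      α₄ ≤ (bondPercolation (zdGraph 3) p').real (percolatesVia (withinGraph (zdGraph 3) (steepSet4 k σ b)) b))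
    (harmₛ : ∀ τ : ℤˣ, ∀ σ : ℤ, (σ = 1 ∨ σ = -1) → ∀ b : Site 3, b ∈ slab 3 k →
      αₛ ≤ (bondPercolation (zdGraph 3) p').real
        (percolatesVia (withinGraph (zdGraph 3)
          {x : Site 3 | x ∈ slab 3 k ∧ (0 ≤ σ * (x 1 - b 1) ∧ 4 * (σ * (x 1 - b 1)) ≤ (τ : ℤ) * (x 2 - b 2))}) b))
    {u : Site 3} (hu : u ∈ boxSet 3 N) (huP : u ∈ {x : Site 3 | x ∈ slab 3 k ∧ (0 ≤ x 2 ∨ c₁ * (x 2 : ℝ) ≤ (x 1 : ℝ) ∨ c₂ * (x 1 : ℝ) ≤ (x 2 : ℝ))})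
    (hbot : u 1 = -(N : ℤ)) (hbD : u - Pi.single 1 1 ∈ {x : Site 3 | x ∈ slab 3 k ∧ (0 ≤ x 2 ∨ c₁ * (x 2 : ℝ) ≤ (x 1 : ℝ) ∨ c₂ * (x 1 : ℝ) ≤ (x 2 : ℝ))}) :
    ∃ E : Set (BondConfig (Site 3)), IsUpperSet E ∧ MeasurableSet E ∧ DeterminedBy E ↑(edgesIn (zdGraph 3) (box 3 (k + 5 * N + 7))) ∧
      α₄ * A.α * αₛ ≤ (bondPercolation (zdGraph 3) p').real E ∧
      ∀ ω ∈ E, ∃ F : Finset (Sym2 (Site 3)), F ⊆ edgesIn (zdGraph 3) (box 3 (k + 5 * N + 7)) ∧ F.card ≤ 2 * k + 2 ∧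
        ω ∪ ↑F ∈ openConnVia (starGraph (withinGraph (zdGraph 3) {x : Site 3 | x ∈ slab 3 k ∧ (0 ≤ x 2 ∨ c₁ * (x 2 : ℝ) ≤ (x 1 : ℝ) ∨ c₂ * (x 1 : ℝ) ≤ (x 2 : ℝ))})
          Set.univ (boxSet 3 N)) u ![0, (N : ℤ) + 1, -(4 * (N : ℤ) + 6)] := by
  have hu0 : 0 ≤ u 0 ∧ u 0 ≤ (k : ℤ) := huP.1
  have hub := mem_boxSet_iff.1 hu
  have hu2 := hub 2
  set Ω : Site 3 := ![0, (N : ℤ) + 1, -(4 * (N : ℤ) + 6)] with hΩ_def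
  have hΩ0 : Ω 0 = 0 := by simp [hΩ_def]
  have hΩ1 : Ω 1 = (N : ℤ) + 1 := by simp [hΩ_def]
  have hΩ2 : Ω 2 = -(4 * (N : ℤ) + 6) := by simp [hΩ_def]
  have hΩslab : Ω ∈ slab 3 k := by show 0 ≤ Ω 0 ∧ Ω 0 ≤ (k : ℤ); rw [hΩ0]; exact ⟨le_rfl, by positivity⟩
  have hcyl : ∀ x ∈ {x : Site 3 | x ∈ slab 3 k ∧ (0 ≤ x 2 ∨ c₁ * (x 2 : ℝ) ≤ (x 1 : ℝ) ∨ c₂ * (x 1 : ℝ) ≤ (x 2 : ℝ))}, ∀ y ∈ slab 3 k, y 1 = x 1 → y 2 = x 2 →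
      y ∈ {x : Site 3 | x ∈ slab 3 k ∧ (0 ≤ x 2 ∨ c₁ * (x 2 : ℝ) ≤ (x 1 : ℝ) ∨ c₂ * (x 1 : ℝ) ≤ (x 2 : ℝ))} :=
    fun x hx y hy h1 h2 => ⟨hy, by rw [h1, h2]; exact hx.2⟩
  have hH : ∀ x ∈ shallowReg k Ω (3 * (N : ℤ) + 5), x ∈ {x : Site 3 | x ∈ slab 3 k ∧ (0 ≤ x 2 ∨ c₁ * (x 2 : ℝ) ≤ (x 1 : ℝ) ∨ c₂ * (x 1 : ℝ) ≤ (x 2 : ℝ))} ∧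
      x ∉ boxSet 3 N ∧ x 1 ≤ 5 * (N : ℤ) + 7 := by
    intro x hx
    obtain ⟨h0, h1, h2, h3, hZ⟩ := shallowReg_props hx
    rw [hΩ1] at h1 h2; rw [hΩ2] at h2 h3
    refine ⟨⟨h0, ?_⟩, not_mem_boxSet_of_lt (j := 1) (by rw [abs_of_nonneg (by omega)]; omega), by omega⟩
    by_cases hx2 : 0 ≤ x 2
    · exact Or.inl hx2
    · have h2r : (x 2 : ℝ) ≤ 0 := by exact_mod_cast (le_of_lt (not_le.1 hx2))
      have h1r : (0 : ℝ) ≤ (x 1 : ℝ) := by exact_mod_cast (show (0 : ℤ) ≤ x 1 by omega)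
      exact Or.inr (Or.inl ((mul_nonpos_iff.2 (Or.inl ⟨hc₂.trans hc, h2r⟩)).trans h1r))
  have hwinH : ∀ x ∈ shallowReg k Ω (3 * (N : ℤ) + 5), ∀ j, |x j| ≤ (k + 5 * N + 7 : ℕ) := by
    intro x hx j
    obtain ⟨h0, h1, h2, h3, hZ⟩ := shallowReg_props hx
    rw [hΩ1] at h1 h2; rw [hΩ2] at h2 h3
    fin_cases j <;> rw [abs_le] <;> push_cast <;> constructor <;> omega
  have hq0 : 0 ≤ α₄ * A.α := (mul_pos hα₄ A.α_pos).le
  have hprobH : A.α ≤ (bondPercolation (zdGraph 3) p').real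
      (reachEvent (withinGraph (zdGraph 3) (shallowReg k Ω (3 * (N : ℤ) + 5))) Ω {x | x 2 = 3 * (N : ℤ) + 5}) :=
    le_real_of_subset (percolatesVia_subset_reachEvent_le (self_mem_shallowSet hΩslab) 2 (by rw [hΩ2]; omega)
      (by simpa only [HalfSlabUniq.shallowReg] using shallowReg_finite (k := k) Ω (3 * (N : ℤ) + 5))) (A.shallow_arm Ω hΩslab)
  have hwu : ∀ j, |u j| ≤ (k + 5 * N + 7 : ℕ) := abs_le_of_mem_boxSet hu (by omega)
  -- the exit `b = u − e₁`
  set b : Site 3 := u - Pi.single 1 1 with hb_def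
  have hb0 : b 0 = u 0 := by simp [hb_def]
  have hb1 : b 1 = u 1 - 1 := by simp [hb_def]
  have hb2 : b 2 = u 2 := by simp [hb_def]
  have hbslab : b ∈ slab 3 k := by show 0 ≤ b 0 ∧ b 0 ≤ (k : ℤ); rw [hb0]; exact hu0
  have hbbox : b ∉ boxSet 3 N := not_mem_boxSet_of_lt (j := 1) (by rw [hb1, hbot, abs_of_nonpos (by omega)]; omega)
  have hadj : (zdGraph 3).Adj u b := (zdGraph_adj_iff _ _).2 ⟨1, Or.inr (by rw [hb_def, sub_add_cancel])⟩
  have hwb : ∀ j, |b j| ≤ (k + 5 * N + 7 : ℕ) := abs_le_of_mem_boxSet (sub_single_mem_boxSet hu 1) (by omega)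
  set T : ℤ := 5 * (N : ℤ) + 7 with hT
  have key : c₂ * (b 1 : ℝ) ≤ (b 2 : ℝ) ∨ (c₁ * (b 2 : ℝ) ≤ (b 1 : ℝ) ∧ u 2 < 0) := by
    have hb1r : ((b 1 : ℤ) : ℝ) = -(N : ℝ) - 1 := by rw [hb1, hbot]; push_cast; ring
    have hN0 : (0 : ℝ) ≤ (N : ℝ) := by positivity
    rcases hbD.2 with h | h | h
    · left
      have h' : (0 : ℝ) ≤ (b 2 : ℝ) := by exact_mod_cast h
      have : c₂ * (b 1 : ℝ) ≤ 0 := by rw [hb1r]; nlinarith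
      linarith
    · right
      refine ⟨h, ?_⟩
      by_contra hge
      push Not at hge
      have h' : (0 : ℝ) ≤ (b 2 : ℝ) := by exact_mod_cast (show (0 : ℤ) ≤ b 2 by rw [hb2]; exact hge)
      have : 0 ≤ c₁ * (b 2 : ℝ) := mul_nonneg (hc₂.trans hc) h'
      rw [hb1r] at h
      linarith
    · left; exact h
  rcases key with hs | ⟨hbc, hu2s⟩
  · -- RIGHTWARD chain (exit under the right half or in the south pocket): swapped arm from `b` to `{x₂ = 3N+5}`, connector
    -- `c₀ = (u₀, −(2N+3), N+2)` leaning `+e₂`, the sweep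
    set c₀ : Site 3 := ![u 0, -(2 * (N : ℤ) + 3), (N : ℤ) + 2] with hc_def
    have hc0 : c₀ 0 = u 0 := by simp [hc_def]
    have hc1 : c₀ 1 = -(2 * (N : ℤ) + 3) := by simp [hc_def]
    have hc2 : c₀ 2 = (N : ℤ) + 2 := by simp [hc_def]
    set T₂ : ℤ := 3 * (N : ℤ) + 5 with hT₂
    have hcslab : c₀ ∈ slab 3 k := by show 0 ≤ c₀ 0 ∧ c₀ 0 ≤ (k : ℤ); rw [hc0]; exact hu0
    have hbP : b ∈ {x : Site 3 | x ∈ slab 3 k ∧ (0 ≤ x 2 ∨ c₁ * (x 2 : ℝ) ≤ (x 1 : ℝ) ∨ c₂ * (x 1 : ℝ) ≤ (x 2 : ℝ))} := hbD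
    set H₁ : Set (Site 3) := {x : Site 3 | x ∈ slab 3 k ∧
      (0 ≤ (-1 : ℤ) * (x 1 - b 1) ∧ 4 * ((-1 : ℤ) * (x 1 - b 1)) ≤ ((1 : ℤˣ) : ℤ) * (x 2 - b 2))} ∩ {x | x 2 ≤ T₂} with hH₁
    set S₂ : Set (Site 3) := steepSet4 k 1 c₀ ∩ {x | x 1 ≤ T} with hS₂
    have hbH₁ : b ∈ H₁ := ⟨⟨hbslab, by simp, by simp⟩, by show b 2 ≤ T₂; rw [hb2]; omega⟩
    have hcS₂ : c₀ ∈ S₂ := ⟨self_mem_steepSet4 hcslab, by show c₀ 1 ≤ T; rw [hc1]; omega⟩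
    have hH₁props : ∀ x ∈ H₁, (0 ≤ x 0 ∧ x 0 ≤ (k : ℤ)) ∧ (c₀ 1 ≤ x 1 ∧ x 1 ≤ b 1) ∧ (b 2 ≤ x 2 ∧ x 2 ≤ T₂) := by
      rintro x ⟨⟨h0, h1, h2⟩, hxT⟩
      have hxT' : x 2 ≤ T₂ := hxT
      rw [Units.val_one, one_mul] at h2
      rw [neg_one_mul] at h1 h2
      rw [hc1]; rw [hb1, hbot] at h1 h2 ⊢; rw [hb2] at h2 ⊢
      exact ⟨h0, ⟨by omega, by omega⟩, ⟨by omega, hxT'⟩⟩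
    have hS₂props : ∀ x ∈ S₂, (0 ≤ x 0 ∧ x 0 ≤ (k : ℤ)) ∧ (c₀ 1 ≤ x 1 ∧ x 1 ≤ T) ∧ ((N : ℤ) + 2 ≤ x 2 ∧ x 2 ≤ T₂) := by
      rintro x ⟨⟨h0, h1, h2⟩, hxT⟩
      have hxT' : x 1 ≤ T := hxT
      rw [hc2, one_mul] at h1 h2; rw [hc1] at h2 ⊢
      exact ⟨h0, ⟨by omega, hxT'⟩, ⟨by omega, by omega⟩⟩
    have hH₁D : ∀ x ∈ H₁, x ∈ {x : Site 3 | x ∈ slab 3 k ∧ (0 ≤ x 2 ∨ c₁ * (x 2 : ℝ) ≤ (x 1 : ℝ) ∨ c₂ * (x 1 : ℝ) ≤ (x 2 : ℝ))} ∧ x ∉ boxSet 3 N := fun x hx => by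
      obtain ⟨h0, ⟨-, h1⟩, ⟨h2, -⟩⟩ := hH₁props x hx
      refine ⟨mem_rtw_of_southArm hc₂ hs h0 h1 h2, not_mem_boxSet_of_lt (j := 1) ?_⟩
      rw [hb1, hbot] at h1; rw [abs_of_nonpos (by omega)]; omega
    have hS₂D : ∀ x ∈ S₂, x ∈ {x : Site 3 | x ∈ slab 3 k ∧ (0 ≤ x 2 ∨ c₁ * (x 2 : ℝ) ≤ (x 1 : ℝ) ∨ c₂ * (x 1 : ℝ) ≤ (x 2 : ℝ))} ∧ x ∉ boxSet 3 N := fun x hx => by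
      obtain ⟨h0, -, ⟨h2, -⟩⟩ := hS₂props x hx
      exact ⟨⟨h0, Or.inl (by omega)⟩, not_mem_boxSet_of_lt (j := 2) (by rw [abs_of_nonneg (by omega)]; omega)⟩
    have hM₁ : ∀ x ∈ S₂ ∪ H₁, ∀ j, |x j| ≤ (k + 5 * N + 7 : ℕ) := by
      rintro x (hx | hx) j
      · obtain ⟨h0, ⟨h1, h2⟩, ⟨h3, h4⟩⟩ := hS₂props x hx
        rw [hc1] at h1
        fin_cases j <;> rw [abs_le] <;> push_cast <;> constructor <;> omega
      · obtain ⟨h0, ⟨h1, h2⟩, ⟨h3, h4⟩⟩ := hH₁props x hx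
        rw [hc1] at h1; rw [hb1, hbot] at h2; rw [hb2] at h3
        fin_cases j <;> rw [abs_le] <;> push_cast <;> constructor <;> omega
    have hM₂ : ∀ x ∈ S₂ ∪ shallowReg k Ω (3 * (N : ℤ) + 5), ∀ j, |x j| ≤ (k + 5 * N + 7 : ℕ) := by
      rintro x (hx | hx) j
      · exact hM₁ x (Or.inl hx) j
      · exact hwinH x hx j
    set E₂ : Set (BondConfig (Site 3)) := reachEvent (withinGraph (zdGraph 3) S₂) c₀ {x | x 1 = T} ∩
      reachEvent (withinGraph (zdGraph 3) (shallowReg k Ω (3 * (N : ℤ) + 5))) Ω {x | x 2 = 3 * (N : ℤ) + 5} with hE₂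
    set E₁ : Set (BondConfig (Site 3)) := reachEvent (withinGraph (zdGraph 3) H₁) b {x | x 2 = T₂} with hE₁
    have hS₂fin : S₂.Finite := (boxSet_finite _).subset (subset_boxSet_of_abs_le fun x hx => hM₁ x (Or.inl hx))
    have hH₁fin : H₁.Finite := (boxSet_finite _).subset (subset_boxSet_of_abs_le fun x hx => hM₁ x (Or.inr hx))
    have hprobS₂ : α₄ ≤ (bondPercolation (zdGraph 3) p').real (reachEvent (withinGraph (zdGraph 3) S₂) c₀ {x | x 1 = T}) :=
      le_real_of_subset (percolatesVia_subset_reachEvent_le (self_mem_steepSet4 hcslab) 1 (by rw [hc1]; omega)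
        (by simpa [hS₂] using hS₂fin)) (harm₄ 1 (Or.inl rfl) c₀ hcslab)
    have hprobH₁ : αₛ ≤ (bondPercolation (zdGraph 3) p').real E₁ :=
      le_real_of_subset (percolatesVia_subset_reachEvent_le (S := {x : Site 3 | x ∈ slab 3 k ∧
          (0 ≤ (-1 : ℤ) * (x 1 - b 1) ∧ 4 * ((-1 : ℤ) * (x 1 - b 1)) ≤ ((1 : ℤˣ) : ℤ) * (x 2 - b 2))}) ⟨hbslab, by simp, by simp⟩ 2
          (by rw [hb2]; omega) (by simpa [hH₁] using hH₁fin)) (harmₛ 1 (-1) (Or.inr rfl) b hbslab)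
    have hE₂upper : IsUpperSet E₂ := (isUpperSet_reachEvent _ _ _).inter (isUpperSet_reachEvent _ _ _)
    have hE₂meas : MeasurableSet E₂ := (measurableSet_reachEvent _ _ _).inter (measurableSet_reachEvent _ _ _)
    have hprobE₂ : α₄ * A.α ≤ (bondPercolation (zdGraph 3) p').real E₂ :=
      harris2_of_le p' (isUpperSet_reachEvent _ _ _) (isUpperSet_reachEvent _ _ _) (measurableSet_reachEvent _ _ _)
        (measurableSet_reachEvent _ _ _) hα₄.le hprobS₂ hprobH
    refine ⟨E₂ ∩ E₁, hE₂upper.inter (isUpperSet_reachEvent _ _ _), hE₂meas.inter (measurableSet_reachEvent _ _ _), ?_, ?_,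
      fun ω hω => ?_⟩
    · exact (((determinedBy_reachEvent _ _ _).mono (edgeSet_withinGraph_subset_edgesIn (subset_boxSet_of_abs_le fun x hx =>
        hM₁ x (Or.inl hx)))).inter ((determinedBy_reachEvent _ _ _).mono (edgeSet_withinGraph_subset_edgesIn
          (subset_boxSet_of_abs_le fun x hx => hwinH x hx)))).inter
        ((determinedBy_reachEvent _ _ _).mono (edgeSet_withinGraph_subset_edgesIn (subset_boxSet_of_abs_le fun x hx => hM₁ x (Or.inr hx))))
    · exact harris2_of_le p' hE₂upper (isUpperSet_reachEvent _ _ _) hE₂meas (measurableSet_reachEvent _ _ _) hq0 hprobE₂ hprobH₁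
    · obtain ⟨hω₂, hω₁⟩ := hω
      obtain ⟨F₂, hF₂s, hF₂c, hF₂r⟩ := move_apex_cyl_region (D := {x : Site 3 | x ∈ slab 3 k ∧ (0 ≤ x 2 ∨ c₁ * (x 2 : ℝ) ≤ (x 1 : ℝ) ∨ c₂ * (x 1 : ℝ) ≤ (x 2 : ℝ))})
        (by omega) hcyl (S := S₂) (fun x hx => (hS₂props x hx).1) hcS₂ hΩslab (by rw [hΩ2]; omega) (by rw [hc1, hΩ1]; omega)
        (fun x hx => ⟨(hS₂D x hx).1, (hS₂D x hx).2, (hS₂props x hx).2.1, by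
          obtain ⟨-, -, h3, h4⟩ := hS₂props x hx; rw [hΩ2]; exact ⟨by omega, by omega⟩⟩) hH hM₂ hω₂
      have hKJ : ∀ s ∈ S₂, ∀ t ∈ H₁, s 1 = t 1 → s 2 = t 2 →
          withinGraph (zdGraph 3) {z | ∀ j, min (s j) (t j) ≤ z j ∧ z j ≤ max (s j) (t j)} ≤
            starGraph (withinGraph (zdGraph 3) {x : Site 3 | x ∈ slab 3 k ∧ (0 ≤ x 2 ∨ c₁ * (x 2 : ℝ) ≤ (x 1 : ℝ) ∨ c₂ * (x 1 : ℝ) ≤ (x 2 : ℝ))})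
              Set.univ (boxSet 3 N) := by
        intro s hs t ht h1 h2
        refine withinGraph_le_dext fun z hz => ?_
        obtain ⟨hs0, -, ⟨hs2, -⟩⟩ := hS₂props s hs
        obtain ⟨ht0, -, -⟩ := hH₁props t ht
        have hz2 : z 2 = s 2 := eq_of_mem_bbox hz h2
        have hz0 := hz 0
        refine ⟨⟨⟨le_trans (le_min hs0.1 ht0.1) hz0.1, le_trans hz0.2 (max_le hs0.2 ht0.2)⟩, Or.inl (by rw [hz2]; omega)⟩,
          not_mem_boxSet_of_lt (j := 2) ?_⟩
        rw [hz2, abs_of_nonneg (by omega)]; omega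
      obtain ⟨F₁, hF₁s, hF₁c, hF₁r⟩ := link_regions (S := S₂) (H := H₁) (fun x hx => (hS₂props x hx).1) (fun x hx => (hH₁props x hx).1)
        hcS₂ hbH₁ (fun x hx => ⟨(hS₂props x hx).2.1.1, (hS₂props x hx).2.1.2, by
          rw [hb2]; have := (hS₂props x hx).2.2.1; have := hu2.2; omega, (hS₂props x hx).2.2.2⟩)
        (fun x hx => ⟨(hH₁props x hx).2.1.1, (hH₁props x hx).2.1.2.trans (by rw [hb1]; omega), (hH₁props x hx).2.2.1,
          (hH₁props x hx).2.2.2⟩)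
        (withinGraph_le_dext hS₂D) (withinGraph_le_dext hH₁D) hKJ hM₁ ⟨hω₂.1, hω₁⟩
      have hbc : ω ∪ ↑F₁ ∈ openConnVia (starGraph (withinGraph (zdGraph 3) {x : Site 3 | x ∈ slab 3 k ∧ (0 ≤ x 2 ∨ c₁ * (x 2 : ℝ) ≤ (x 1 : ℝ) ∨ c₂ * (x 1 : ℝ) ≤ (x 2 : ℝ))})
          Set.univ (boxSet 3 N)) b c₀ := mem_openConnVia_iff.2 (mem_openConnVia_iff.1 hF₁r).symm
      have hbΩ := openConnVia_trans hbc hF₂r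
      have hcard : (insert s(u, b) (F₁ ∪ F₂)).card ≤ 2 * k + 2 :=
        (Finset.card_insert_le _ _).trans (by have := Finset.card_union_le F₁ F₂; omega)
      refine ⟨insert s(u, b) (F₁ ∪ F₂), ?_, hcard, ?_⟩
      · intro e he
        rcases Finset.mem_insert.1 he with rfl | he
        · exact mem_edgesIn_of_adj hadj hwu hwb
        · rcases Finset.mem_union.1 he with he | he
          · exact hF₁s he
          · exact hF₂s he
      · exact openConnVia_step (dext_adj_of hadj huP hbP fun h' => hbbox h'.2) (Finset.mem_insert_self _ _)
          (openConnVia_mono_finset (Finset.subset_insert _ _) hbΩ)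
  · -- LEFTWARD pocket chain (exit in the west pocket): `u₂ < 0`, `c₁·u₂ ≤ −(N+1)`, so `c₁ ≥ 1`; connector `w₁ = (u₀, −(2N+3), −(2N+3))`
    have hb2r : (b 2 : ℝ) ≤ -1 := by exact_mod_cast (show b 2 ≤ -1 by rw [hb2]; omega)
    have hb2N : (-(N : ℝ)) ≤ (b 2 : ℝ) := by exact_mod_cast (show -(N : ℤ) ≤ b 2 by rw [hb2]; exact hu2.1)
    have hb1r : ((b 1 : ℤ) : ℝ) = -(N : ℝ) - 1 := by rw [hb1, hbot]; push_cast; ring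
    have hc1 : 1 ≤ c₁ := by
      by_contra h
      push Not at h
      nlinarith
    have hbP : b ∈ {x : Site 3 | x ∈ slab 3 k ∧ (0 ≤ x 2 ∨ c₁ * (x 2 : ℝ) ≤ (x 1 : ℝ) ∨ c₂ * (x 1 : ℝ) ≤ (x 2 : ℝ))} := hbD
    set w₁ : Site 3 := ![u 0, -(2 * (N : ℤ) + 3), -(2 * (N : ℤ) + 3)] with hc_def
    have hc0 : w₁ 0 = u 0 := by simp [hc_def]
    have hc1' : w₁ 1 = -(2 * (N : ℤ) + 3) := by simp [hc_def]
    have hc2 : w₁ 2 = -(2 * (N : ℤ) + 3) := by simp [hc_def]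
    set L : ℤ := -(4 * (N : ℤ) + 6) with hL
    have hcslab : w₁ ∈ slab 3 k := by show 0 ≤ w₁ 0 ∧ w₁ 0 ≤ (k : ℤ); rw [hc0]; exact hu0
    set H₁ : Set (Site 3) := {x : Site 3 | x ∈ slab 3 k ∧
      (0 ≤ (-1 : ℤ) * (x 1 - b 1) ∧ 4 * ((-1 : ℤ) * (x 1 - b 1)) ≤ ((-1 : ℤˣ) : ℤ) * (x 2 - b 2))} ∩ {x | L ≤ x 2} with hH₁
    set S₂ : Set (Site 3) := steepSet4 k (-1) w₁ ∩ {x | x 1 ≤ T} with hS₂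
    have hbH₁ : b ∈ H₁ := ⟨⟨hbslab, by simp, by simp⟩, by show L ≤ b 2; rw [hb2]; omega⟩
    have hcS₂ : w₁ ∈ S₂ := ⟨self_mem_steepSet4 hcslab, by show w₁ 1 ≤ T; rw [hc1']; omega⟩
    have hH₁props : ∀ x ∈ H₁, (0 ≤ x 0 ∧ x 0 ≤ (k : ℤ)) ∧ (w₁ 1 ≤ x 1 ∧ x 1 ≤ b 1) ∧ (L ≤ x 2 ∧ x 2 ≤ b 2) ∧ b 1 - x 1 ≤ b 2 - x 2 := by
      rintro x ⟨⟨h0, h1, h2⟩, hxL⟩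
      have hxL' : L ≤ x 2 := hxL
      rw [Units.val_neg, Units.val_one] at h2
      rw [neg_one_mul] at h1 h2
      rw [hc1']; rw [hb1, hbot] at h1 h2 ⊢; rw [hb2] at h2 ⊢
      exact ⟨h0, ⟨by omega, by omega⟩, ⟨hxL', by omega⟩, by omega⟩
    have hS₂props : ∀ x ∈ S₂, (0 ≤ x 0 ∧ x 0 ≤ (k : ℤ)) ∧ (w₁ 1 ≤ x 1 ∧ x 1 ≤ T) ∧ (L ≤ x 2 ∧ x 2 ≤ -(2 * (N : ℤ) + 3)) := by
      rintro x ⟨⟨h0, h1, h2⟩, hxT⟩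
      have hxT' : x 1 ≤ T := hxT
      rw [hc2, neg_one_mul] at h1 h2; rw [hc1'] at h2 ⊢
      exact ⟨h0, ⟨by omega, hxT'⟩, ⟨by omega, by omega⟩⟩
    have hH₁D : ∀ x ∈ H₁, x ∈ {x : Site 3 | x ∈ slab 3 k ∧ (0 ≤ x 2 ∨ c₁ * (x 2 : ℝ) ≤ (x 1 : ℝ) ∨ c₂ * (x 1 : ℝ) ≤ (x 2 : ℝ))} ∧ x ∉ boxSet 3 N := fun x hx => by
      obtain ⟨h0, ⟨-, h1⟩, -, h12⟩ := hH₁props x hx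
      refine ⟨mem_rtw_of_pocketArm hc1 hbc h0 h1 h12, not_mem_boxSet_of_lt (j := 1) ?_⟩
      rw [hb1, hbot] at h1; rw [abs_of_nonpos (by omega)]; omega
    have hS₂D : ∀ x ∈ S₂, x ∈ {x : Site 3 | x ∈ slab 3 k ∧ (0 ≤ x 2 ∨ c₁ * (x 2 : ℝ) ≤ (x 1 : ℝ) ∨ c₂ * (x 1 : ℝ) ≤ (x 2 : ℝ))} ∧ x ∉ boxSet 3 N := fun x hx => by
      obtain ⟨h0, ⟨h1, -⟩, ⟨-, h2⟩⟩ := hS₂props x hx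
      rw [hc1'] at h1
      exact ⟨mem_rtw_of_le hc1 h0 (by omega) (by omega), not_mem_boxSet_of_lt (j := 2) (by rw [abs_of_nonpos (by omega)]; omega)⟩
    have hM₁ : ∀ x ∈ S₂ ∪ H₁, ∀ j, |x j| ≤ (k + 5 * N + 7 : ℕ) := by
      rintro x (hx | hx) j
      · obtain ⟨h0, ⟨h1, h2⟩, ⟨h3, h4⟩⟩ := hS₂props x hx
        rw [hc1'] at h1
        fin_cases j <;> rw [abs_le] <;> push_cast <;> constructor <;> omega
      · obtain ⟨h0, ⟨h1, h2⟩, ⟨h3, h4⟩, -⟩ := hH₁props x hx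
        rw [hc1'] at h1; rw [hb1, hbot] at h2; rw [hb2] at h4
        fin_cases j <;> rw [abs_le] <;> push_cast <;> constructor <;> omega
    have hM₂ : ∀ x ∈ S₂ ∪ shallowReg k Ω (3 * (N : ℤ) + 5), ∀ j, |x j| ≤ (k + 5 * N + 7 : ℕ) := by
      rintro x (hx | hx) j
      · exact hM₁ x (Or.inl hx) j
      · exact hwinH x hx j
    set E₂ : Set (BondConfig (Site 3)) := reachEvent (withinGraph (zdGraph 3) S₂) w₁ {x | x 1 = T} ∩
      reachEvent (withinGraph (zdGraph 3) (shallowReg k Ω (3 * (N : ℤ) + 5))) Ω {x | x 2 = 3 * (N : ℤ) + 5} with hE₂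
    set E₁ : Set (BondConfig (Site 3)) := reachEvent (withinGraph (zdGraph 3) H₁) b {x | x 2 = L} with hE₁
    have hS₂fin : S₂.Finite := (boxSet_finite _).subset (subset_boxSet_of_abs_le fun x hx => hM₁ x (Or.inl hx))
    have hH₁fin : H₁.Finite := (boxSet_finite _).subset (subset_boxSet_of_abs_le fun x hx => hM₁ x (Or.inr hx))
    have hprobS₂ : α₄ ≤ (bondPercolation (zdGraph 3) p').real (reachEvent (withinGraph (zdGraph 3) S₂) w₁ {x | x 1 = T}) :=
      le_real_of_subset (percolatesVia_subset_reachEvent_le (self_mem_steepSet4 hcslab) 1 (by rw [hc1']; omega)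
        (by simpa [hS₂] using hS₂fin)) (harm₄ (-1) (Or.inr rfl) w₁ hcslab)
    have hprobH₁ : αₛ ≤ (bondPercolation (zdGraph 3) p').real E₁ :=
      le_real_of_subset (percolatesVia_subset_reachEvent_ge (S := {x : Site 3 | x ∈ slab 3 k ∧
          (0 ≤ (-1 : ℤ) * (x 1 - b 1) ∧ 4 * ((-1 : ℤ) * (x 1 - b 1)) ≤ ((-1 : ℤˣ) : ℤ) * (x 2 - b 2))}) ⟨hbslab, by simp, by simp⟩ 2
          (by rw [hb2]; omega) (by simpa [hH₁] using hH₁fin)) (harmₛ (-1) (-1) (Or.inr rfl) b hbslab)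
    have hE₂upper : IsUpperSet E₂ := (isUpperSet_reachEvent _ _ _).inter (isUpperSet_reachEvent _ _ _)
    have hE₂meas : MeasurableSet E₂ := (measurableSet_reachEvent _ _ _).inter (measurableSet_reachEvent _ _ _)
    have hprobE₂ : α₄ * A.α ≤ (bondPercolation (zdGraph 3) p').real E₂ :=
      harris2_of_le p' (isUpperSet_reachEvent _ _ _) (isUpperSet_reachEvent _ _ _) (measurableSet_reachEvent _ _ _)
        (measurableSet_reachEvent _ _ _) hα₄.le hprobS₂ hprobH
    refine ⟨E₂ ∩ E₁, hE₂upper.inter (isUpperSet_reachEvent _ _ _), hE₂meas.inter (measurableSet_reachEvent _ _ _), ?_, ?_,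
      fun ω hω => ?_⟩
    · exact (((determinedBy_reachEvent _ _ _).mono (edgeSet_withinGraph_subset_edgesIn (subset_boxSet_of_abs_le fun x hx =>
        hM₁ x (Or.inl hx)))).inter ((determinedBy_reachEvent _ _ _).mono (edgeSet_withinGraph_subset_edgesIn
          (subset_boxSet_of_abs_le fun x hx => hwinH x hx)))).inter
        ((determinedBy_reachEvent _ _ _).mono (edgeSet_withinGraph_subset_edgesIn (subset_boxSet_of_abs_le fun x hx => hM₁ x (Or.inr hx))))
    · exact harris2_of_le p' hE₂upper (isUpperSet_reachEvent _ _ _) hE₂meas (measurableSet_reachEvent _ _ _) hq0 hprobE₂ hprobH₁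
    · obtain ⟨hω₂, hω₁⟩ := hω
      obtain ⟨F₂, hF₂s, hF₂c, hF₂r⟩ := move_apex_cyl_region (D := {x : Site 3 | x ∈ slab 3 k ∧ (0 ≤ x 2 ∨ c₁ * (x 2 : ℝ) ≤ (x 1 : ℝ) ∨ c₂ * (x 1 : ℝ) ≤ (x 2 : ℝ))})
        (by omega) hcyl (S := S₂) (fun x hx => (hS₂props x hx).1) hcS₂ hΩslab (by rw [hΩ2]; omega) (by rw [hc1', hΩ1]; omega)
        (fun x hx => ⟨(hS₂D x hx).1, (hS₂D x hx).2, (hS₂props x hx).2.1, by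
          obtain ⟨-, -, h3, h4⟩ := hS₂props x hx; rw [hΩ2]; exact ⟨by omega, by omega⟩⟩) hH hM₂ hω₂
      have hKJ : ∀ s ∈ S₂, ∀ t ∈ H₁, s 1 = t 1 → s 2 = t 2 →
          withinGraph (zdGraph 3) {z | ∀ j, min (s j) (t j) ≤ z j ∧ z j ≤ max (s j) (t j)} ≤
            starGraph (withinGraph (zdGraph 3) {x : Site 3 | x ∈ slab 3 k ∧ (0 ≤ x 2 ∨ c₁ * (x 2 : ℝ) ≤ (x 1 : ℝ) ∨ c₂ * (x 1 : ℝ) ≤ (x 2 : ℝ))})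
              Set.univ (boxSet 3 N) := by
        intro s hs t ht h1 h2
        refine withinGraph_le_dext fun z hz => ?_
        obtain ⟨hs0, ⟨hs1, -⟩, ⟨-, hs2⟩⟩ := hS₂props s hs
        obtain ⟨ht0, -, -⟩ := hH₁props t ht
        rw [hc1'] at hs1
        have hz1 : z 1 = s 1 := eq_of_mem_bbox hz h1
        have hz2 : z 2 = s 2 := eq_of_mem_bbox hz h2
        have hz0 := hz 0
        have hzslab : z ∈ slab 3 k := ⟨le_trans (le_min hs0.1 ht0.1) hz0.1, le_trans hz0.2 (max_le hs0.2 ht0.2)⟩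
        refine ⟨mem_rtw_of_le hc1 hzslab (by rw [hz2]; omega) (by rw [hz1, hz2]; omega), not_mem_boxSet_of_lt (j := 2) ?_⟩
        rw [hz2, abs_of_nonpos (by omega)]; omega
      obtain ⟨F₁, hF₁s, hF₁c, hF₁r⟩ := link_regions_left (S := S₂) (H := H₁) (fun x hx => (hS₂props x hx).1)
        (fun x hx => (hH₁props x hx).1) hcS₂ hbH₁
        (fun x hx => ⟨(hS₂props x hx).2.1.1, (hS₂props x hx).2.1.2, (hS₂props x hx).2.2.1, by
          rw [hb2]; have := (hS₂props x hx).2.2.2; have := hu2.1; omega⟩)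
        (fun x hx => ⟨(hH₁props x hx).2.1.1, (hH₁props x hx).2.1.2.trans (by rw [hb1]; omega), (hH₁props x hx).2.2.1.1,
          (hH₁props x hx).2.2.1.2⟩)
        (withinGraph_le_dext hS₂D) (withinGraph_le_dext hH₁D) hKJ hM₁ ⟨hω₂.1, hω₁⟩
      have hbc' : ω ∪ ↑F₁ ∈ openConnVia (starGraph (withinGraph (zdGraph 3) {x : Site 3 | x ∈ slab 3 k ∧ (0 ≤ x 2 ∨ c₁ * (x 2 : ℝ) ≤ (x 1 : ℝ) ∨ c₂ * (x 1 : ℝ) ≤ (x 2 : ℝ))})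
          Set.univ (boxSet 3 N)) b w₁ := mem_openConnVia_iff.2 (mem_openConnVia_iff.1 hF₁r).symm
      have hbΩ := openConnVia_trans hbc' hF₂r
      have hcard : (insert s(u, b) (F₁ ∪ F₂)).card ≤ 2 * k + 2 :=
        (Finset.card_insert_le _ _).trans (by have := Finset.card_union_le F₁ F₂; omega)
      refine ⟨insert s(u, b) (F₁ ∪ F₂), ?_, hcard, ?_⟩
      · intro e he
        rcases Finset.mem_insert.1 he with rfl | he
        · exact mem_edgesIn_of_adj hadj hwu hwb
        · rcases Finset.mem_union.1 he with he | he
          · exact hF₁s he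
          · exact hF₂s he
      · exact openConnVia_step (dext_adj_of hadj huP hbP fun h' => hbbox h'.2) (Finset.mem_insert_self _ _)
          (openConnVia_mono_finset (Finset.subset_insert _ _) hbΩ)

end ReflexQuadPocket

end Summit.CriticalPhenomena.PercolationContinuityZ3.Theorems.Transplant

end
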